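import Summits.QuantumAdvantage.QuantumAdvantage.Theses.MobiusLadder
import Summits.QuantumAdvantage.QuantumAdvantage.Theses.CircuitLB
import Literature.Computability.QuantumComplexity.LiouvilleFactoringOracle
import Literature.Computability.Complexity.CircuitClassesUniformProofs

/-!
# The crux `LiouvilleNotPPoly` dominates the nonuniform factoring assumption

Helper file for the crux `MobiusLadder.LiouvilleNotPPoly` (stmt-QuantumAdvantage-1389), line
`SketchIdeator2`, continuation lead c1. Planner memo M1/B3 and the route reviewers' D2, so far
prose ("X is STRONGER than CircuitLB's `ClbFactNotPpoly` since `λ` is computable from the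
factorisation"), as tree theorems: by `LiouvilleOracle.liouville_mem_PPoly_of_FACT_mem_PPoly`
(`λ` is polynomial-time Turing reducible to the bounded-divisor language `FACT`, and `P/poly` is
closed under such reductions) the crux implies `FACT ∉ P/poly`, which IS the hypothesis `ClbFactNotPpoly` of the closed route
`CircuitLB` (`clbFactNotPpoly_of_liouvilleNotPPoly`, by name), and is refuted by `FACT ∈ P/poly`,
in particular by `FactInP` (`FACT ∈ P`, the open problem pqc.S04). Theorems only.
-/

set_option linter.dupNamespace false -- D-0017: single-problem summit ⇒ `QuantumAdvantage.QuantumAdvantage` by design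

namespace Summit.QuantumAdvantage.QuantumAdvantage.Theorems.LiouvilleNotPPoly

open Literature.Computability.QuantumComplexity Literature.Computability.Complexity
open Summit.QuantumAdvantage.QuantumAdvantage.Theses.MobiusLadder (LiouvilleNotPPoly)

/-- **The crux implies the nonuniform factoring assumption `FACT ∉ P/poly`** (the statement
`CircuitLB.ClbFactNotPpoly`, verbatim): a polynomial-size circuit family for `FACT` yields one for
`L_λ` (peel off least prime factors by binary search with the `FACT` circuits as oracle gates). -/
theorem fact_not_mem_PPoly_of_liouvilleNotPPoly : Summit.QuantumAdvantage.QuantumAdvantage.Theses.MobiusLadder.LiouvilleNotPPoly → Literature.Computability.QuantumComplexity.FACT ∉ Literature.Computability.Complexity.PPoly :=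
  fun h hF => h (LiouvilleOracle.liouville_mem_PPoly_of_FACT_mem_PPoly hF)

/-- **The crux implies `CircuitLB.ClbFactNotPpoly` BY NAME**: the top of route `MobiusLadder`
dominates the hypothesis of the closed route `CircuitLB` (route review D2, planner memo B3). -/
theorem clbFactNotPpoly_of_liouvilleNotPPoly : Summit.QuantumAdvantage.QuantumAdvantage.Theses.MobiusLadder.LiouvilleNotPPoly → Summit.QuantumAdvantage.QuantumAdvantage.Theses.CircuitLB.ClbFactNotPpoly :=
  fun h => fact_not_mem_PPoly_of_liouvilleNotPPoly h

/-- **Refutation surface, enlarged**: `FACT ∈ P/poly` (nonuniform factoring) refutes the crux. -/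
theorem not_liouvilleNotPPoly_of_FACT_mem_PPoly (hF : FACT ∈ PPoly) : ¬ LiouvilleNotPPoly :=
  fun h => fact_not_mem_PPoly_of_liouvilleNotPPoly h hF

/-- `FactInP` (`FACT ∈ P`, the open problem pqc.S04) refutes the crux (`P ⊆ P/poly`). -/
theorem not_liouvilleNotPPoly_of_factInP (hF : FactInP) : ¬ LiouvilleNotPPoly :=
  not_liouvilleNotPPoly_of_FACT_mem_PPoly (P_subset_PPoly_holds hF)

/-- The crux implies `¬ FactInP` ("`λ` hard for circuits ⇒ factoring is not in `P`"). -/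
theorem not_factInP_of_liouvilleNotPPoly (h : LiouvilleNotPPoly) : ¬ FactInP :=
  fun hF => not_liouvilleNotPPoly_of_factInP hF h

/-- **Refutation surface, general form**: any polynomial-time Turing reduction of `L_λ` to a
language with polynomial-size circuits refutes the crux (`P/poly` is closed under `≤ᵖ_T`); the
`FACT` case above is the instance the tree now holds. -/
theorem not_liouvilleNotPPoly_of_polyTimeTuringReducible {A : Language Bool}
    (hred : PolyTimeTuringReducible
      (Computability.encodingNatBool.toLanguage {N : ℕ | ArithmeticFunction.liouville N = -1}) A)
    (hA : A ∈ PPoly) : ¬ LiouvilleNotPPoly :=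
  fun h => h (mem_PPoly_of_polyTimeTuringReducible hred hA)

/-- `L_λ ∈ BPP` refutes the crux (Adleman, `BPP ⊆ P/poly`). -/
theorem not_liouvilleNotPPoly_of_mem_BPP
    (hB : Computability.encodingNatBool.toLanguage {N : ℕ | ArithmeticFunction.liouville N = -1} ∈ BPP) :
    ¬ LiouvilleNotPPoly :=
  fun h => h (BPP_subset_PPoly_holds hB)

/-- **The uniform top the route's `closes` actually consumes** (planner memo M1): the crux implies
`L_λ ∉ BPP` (Adleman, `BPP ⊆ P/poly`, tree theorem), and `closes h₁ h₂` uses `h₂` only through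
this consequence. -/
theorem liouville_not_mem_BPP_of_liouvilleNotPPoly (h : LiouvilleNotPPoly) :
    Computability.encodingNatBool.toLanguage {N : ℕ | ArithmeticFunction.liouville N = -1} ∉ BPP :=
  fun hB => h (BPP_subset_PPoly_holds hB)

end Summit.QuantumAdvantage.QuantumAdvantage.Theorems.LiouvilleNotPPoly
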